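import Mathlib.Analysis.Calculus.Deriv.Inv
import Mathlib.Analysis.Calculus.FDeriv.Pow
import Literature.Probability.LatticeModels.DiluteLoopModel
import Literature.Probability.LatticeModels.DiluteLoopModelSAW
import HarnessLib

/-!
# Positivity and parameter-analyticity of the dilute loop model partition functions

Topic `Literature/Probability/LatticeModels`; companion of `DiluteLoopModel.lean`. Elementary facts about
`Z_{n,w,x}(G, Λ; A)` (`DiluteLoopModel.partitionFunction`) needed to TYPE and to attack the
analytic-continuation items of route `CriticalPhenomena/SAWScalingLimit/SAWLoopFugacityFlow`
(`FugacityAnalyticity` stmt-CriticalPhenomena-5063, `IsingWindow` stmt-CriticalPhenomena-5080), where the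
loop fugacity `n` is continued off the real segment `[0, 1]` ("`n` … can now be allowed to take arbitrary
complex values", Jacobsen, LNP 775, p. 367):

* on the closed positive orthant of parameters (`n, w, x ≥ 0`, e.g. the route's diagonal `w = n/2`,
  `n ∈ [0, 1]`, `x = x_c ≥ 0`) the source-free partition function is `≥ 1` (the empty configuration;
  `one_le_partitionFunction_empty`), and the two-leg partition function is `> 0` as soon as `x > 0` and a
  self-avoiding path from `a` to `b ≠ a` inside `Λ` exists (`partitionFunction_pos_of_path`): the two-leg
  function `Z'/Z` and the route's boundary ratio are honest, positive quotients there — at every FIXED mesh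
  the ratio has no pole ON the real segment, so the content of the route's item is uniformity in the mesh;
* `Z` is a polynomial expression in `(n, w, x)` (`map_partitionFunction`), hence differentiable along
  differentiable parameter curves (`differentiableOn_partitionFunction`; holomorphic for `𝕜 = ℂ`), and
  `twoLeg` / `boundaryRatio` / the diagonal `domainBoundaryRatio` of the route are differentiable wherever
  the source-free partition functions and the two-leg partition function of the larger domain do not vanish
  (`differentiableOn_twoLeg`, `differentiableOn_boundaryRatio`,
  `differentiableOn_diag_domainBoundaryRatio`): a zero-free region in the complex loop fugacity is a
  pole-free region of the ratio;
* the real diagonal ratio coerced to `ℂ` is the complex diagonal ratio at the real point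
  (`ofReal_diag_domainBoundaryRatio`, `ofReal_diag_domainPartitionFunction`, from `map_boundaryRatio` /
  `map_partitionFunction`): the bridge between real-`n` limit statements and complex-`n` continuation
  statements;
* AT A FIXED MESH pole-freeness near `[0, 1]` is automatic
  (`exists_isOpen_differentiableOn_diag_domainBoundaryRatio`: an open `U ⊇ [0, 1]` on which the diagonal
  ratio is differentiable exists as soon as the fugacity curve is real positive on `[0, 1]` and the legs
  are joined by a path) — so in a statement quantifying over all small meshes with one `U` and a uniform
  bound, the entire content is the uniformity in the mesh.

Not here: any UNIFORM-in-volume zero-free region (a Lee–Yang-type theorem in the loop fugacity at the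
critical edge fugacity is not in print), the values of `criticalFugacity` at the two ends of the diagonal.

## References

* W. Guo, H. W. J. Blöte, B. Nienhuis, Int. J. Mod. Phys. C 10 (1999) 301, §1 eq. (1), §2. [GuoBloteNienhuis1999]
* J. L. Jacobsen, *Conformal field theory applied to loop models*, LNP 775 (2009), ch. 14, p. 367
  (complex loop fugacity). [Jacobsen2009]
-/

noncomputable section

open Finset
open scoped symmDiff

namespace Literature.Probability.LatticeModels.DiluteLoopModel

variable {G : SimpleGraph (Site 2)} [G.LocallyFinite]

/-! ### Positivity on the closed positive orthant of parameters -/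

section Positivity

/-- The empty configuration has weight `1` (no edge, no collision, no closed strand). [folklore] -/
@[simp] theorem weight_empty {R : Type*} [CommSemiring R] (L : DiluteLoopModel R) (Λ S : Finset (Site 2)) :
    L.weight Λ ∅ S = 1 := by
  simp [weight]

/-- **`Z_{n,w,x}(G, Λ; ∅) ≥ 1` for `n, w, x ≥ 0`**: every term is nonnegative and the empty
configuration contributes `1`. In particular on the route's diagonal `w = n/2`, `n ∈ [0, 1]`, `x ≥ 0`
the source-free partition functions never vanish. [cite: GuoBloteNienhuis1999, §1 eq. (1)] -/
theorem one_le_partitionFunction_empty {L : DiluteLoopModel ℝ} (hn : 0 ≤ L.n) (hw : 0 ≤ L.w)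
    (hx : 0 ≤ L.x) (Λ : Finset (Site 2)) : 1 ≤ L.partitionFunction G Λ ∅ := by
  have h1 : (1 : ℝ) = ∑ S ∈ (oscVerts Λ (∅ : Finset (Sym2 (Site 2)))).powerset, L.weight Λ ∅ S := by
    simp
  rw [partitionFunction, h1]
  exact single_le_sum (s := configs G Λ ∅)
    (f := fun F => ∑ S ∈ (oscVerts Λ F).powerset, L.weight Λ F S)
    (fun F _ => sum_nonneg fun S _ => weight_nonneg hn hw hx Λ F S) (empty_mem_configs Λ)

/-- `Z_{n,w,x}(G, Λ; ∅) > 0` for `n, w, x ≥ 0`. [cite: GuoBloteNienhuis1999, §1 eq. (1)] -/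
theorem partitionFunction_empty_pos {L : DiluteLoopModel ℝ} (hn : 0 ≤ L.n) (hw : 0 ≤ L.w)
    (hx : 0 ≤ L.x) (Λ : Finset (Site 2)) : 0 < L.partitionFunction G Λ ∅ :=
  zero_lt_one.trans_le (one_le_partitionFunction_empty hn hw hx Λ)

/-- **The two-leg partition function is positive** for `n, w ≥ 0`, `x > 0` on a subgraph of `ℤ²`, as
soon as a self-avoiding path from `a` to `b ≠ a` inside `Λ` exists: its edge set is an admissible,
collision-free, loop-free configuration of weight `x^{|γ|} > 0`. [cite: GuoBloteNienhuis1999, §2 (Z')] -/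
theorem partitionFunction_pos_of_path (hG : G ≤ zdGraph 2) {L : DiluteLoopModel ℝ} (hn : 0 ≤ L.n)
    (hw : 0 ≤ L.w) (hx : 0 < L.x) {Λ : Finset (Site 2)} {a b : Site 2} (hab : a ≠ b) {p : G.Walk a b}
    (hp : p.IsPath) (hΛ : ∀ v ∈ p.support, v ∈ Λ) :
    0 < L.partitionFunction G Λ ({a} ∆ {b}) := by
  classical
  have hF := edgesFinset_mem_configs hp hab hΛ
  have hterm : 0 < ∑ S ∈ (oscVerts Λ p.edges.toFinset).powerset, L.weight Λ p.edges.toFinset S := by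
    rw [oscVerts_edges_eq_empty hG hp Λ, powerset_empty, sum_singleton, weight,
      oscVerts_edges_eq_empty hG hp Λ, loops_edges_eq_zero hG hp hab (hΛ _ p.start_mem_support),
      card_empty, pow_zero, pow_zero, mul_one, mul_one]
    exact pow_pos hx _
  rw [partitionFunction]
  exact hterm.trans_le (single_le_sum
    (f := fun F => ∑ S ∈ (oscVerts Λ F).powerset, L.weight Λ F S)
    (fun F _ => sum_nonneg fun S _ => weight_nonneg hn hw hx.le Λ F S) hF)

/-- The two-leg function `Z'/Z` is nonnegative for `n, w, x ≥ 0`. [cite: GuoBloteNienhuis1999, §2 (Z'/Z)] -/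
theorem twoLeg_nonneg {L : DiluteLoopModel ℝ} (hn : 0 ≤ L.n) (hw : 0 ≤ L.w) (hx : 0 ≤ L.x)
    (Λ : Finset (Site 2)) (a b : Site 2) : 0 ≤ L.twoLeg G Λ a b :=
  div_nonneg (partitionFunction_nonneg hn hw hx Λ _) (partitionFunction_nonneg hn hw hx Λ _)

/-- **The two-leg function `Z'/Z` is positive** for `n, w ≥ 0`, `x > 0` on a subgraph of `ℤ²` whenever
a self-avoiding path from `a` to `b ≠ a` inside `Λ` exists. [cite: GuoBloteNienhuis1999, §2 (Z'/Z)] -/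
theorem twoLeg_pos_of_path (hG : G ≤ zdGraph 2) {L : DiluteLoopModel ℝ} (hn : 0 ≤ L.n) (hw : 0 ≤ L.w)
    (hx : 0 < L.x) {Λ : Finset (Site 2)} {a b : Site 2} (hab : a ≠ b) {p : G.Walk a b} (hp : p.IsPath)
    (hΛ : ∀ v ∈ p.support, v ∈ Λ) : 0 < L.twoLeg G Λ a b :=
  div_pos (partitionFunction_pos_of_path hG hn hw hx hab hp hΛ) (partitionFunction_empty_pos hn hw hx.le Λ)

end Positivity

/-! ### Differentiability in the parameters (polynomial dependence) -/

section Differentiable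

variable {𝕜 : Type*} [NontriviallyNormedField 𝕜] {f g h : 𝕜 → 𝕜} {s : Set 𝕜}

/-- **`Z` is differentiable along differentiable parameter curves**: for differentiable
`f, g, h : 𝕜 → 𝕜` on `s`, `z ↦ Z_{f z, g z, h z}(G, Λ; A)` is differentiable on `s` (a finite sum of
products of powers; for `𝕜 = ℂ`: holomorphic — the loop fugacity as a complex variable). [cite: Jacobsen2009, p. 367 (complex loop fugacity)] -/
theorem differentiableOn_partitionFunction (hf : DifferentiableOn 𝕜 f s) (hg : DifferentiableOn 𝕜 g s)
    (hh : DifferentiableOn 𝕜 h s) (Λ A : Finset (Site 2)) :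
    DifferentiableOn 𝕜 (fun z => (⟨f z, g z, h z⟩ : DiluteLoopModel 𝕜).partitionFunction G Λ A) s := by
  simp only [partitionFunction, weight]
  refine DifferentiableOn.fun_sum fun F _ => DifferentiableOn.fun_sum fun S _ => ?_
  exact ((hh.fun_pow _).fun_mul (hg.fun_pow _)).fun_mul (hf.fun_pow _)

/-- **The two-leg function is differentiable off the zeros of the source-free partition function.**
[cite: Jacobsen2009, p. 367 (complex loop fugacity)] -/
theorem differentiableOn_twoLeg (hf : DifferentiableOn 𝕜 f s) (hg : DifferentiableOn 𝕜 g s)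
    (hh : DifferentiableOn 𝕜 h s) (Λ : Finset (Site 2)) (a b : Site 2)
    (hZ : ∀ z ∈ s, (⟨f z, g z, h z⟩ : DiluteLoopModel 𝕜).partitionFunction G Λ ∅ ≠ 0) :
    DifferentiableOn 𝕜 (fun z => (⟨f z, g z, h z⟩ : DiluteLoopModel 𝕜).twoLeg G Λ a b) s := by
  simp only [twoLeg]
  exact (differentiableOn_partitionFunction hf hg hh Λ _).fun_div
    (differentiableOn_partitionFunction hf hg hh Λ ∅) hZ

/-- **A zero-free region is a pole-free region of the boundary ratio**: if on `s` neither source-free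
partition function vanishes and the two-leg partition function of the larger pair `(G, Λ)` does not
vanish, then `z ↦ R = twoLeg(G', Λ') / twoLeg(G, Λ)` at parameters `(f z, g z, h z)` is differentiable on
`s`. [cite: Jacobsen2009, p. 367 (complex loop fugacity)] -/
theorem differentiableOn_boundaryRatio {G' : SimpleGraph (Site 2)} [G'.LocallyFinite]
    (hf : DifferentiableOn 𝕜 f s) (hg : DifferentiableOn 𝕜 g s) (hh : DifferentiableOn 𝕜 h s)
    (Λ' Λ : Finset (Site 2)) (a b : Site 2)
    (hZ' : ∀ z ∈ s, (⟨f z, g z, h z⟩ : DiluteLoopModel 𝕜).partitionFunction G' Λ' ∅ ≠ 0)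
    (hZ : ∀ z ∈ s, (⟨f z, g z, h z⟩ : DiluteLoopModel 𝕜).partitionFunction G Λ ∅ ≠ 0)
    (hZab : ∀ z ∈ s, (⟨f z, g z, h z⟩ : DiluteLoopModel 𝕜).partitionFunction G Λ ({a} ∆ {b}) ≠ 0) :
    DifferentiableOn 𝕜 (fun z => (⟨f z, g z, h z⟩ : DiluteLoopModel 𝕜).boundaryRatio G' Λ' G Λ a b) s := by
  simp only [boundaryRatio]
  refine (differentiableOn_twoLeg hf hg hh Λ' a b hZ').fun_div
    (differentiableOn_twoLeg hf hg hh Λ a b hZ) fun z hz => ?_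
  rw [twoLeg]
  exact div_ne_zero (hZab z hz) (hZ z hz)

/-- **The route's diagonal boundary ratio is holomorphic on a zero-free region**: for an edge-fugacity
curve `xc` differentiable on `U` (e.g. a holomorphic extension of `n ↦ x_c(n, n/2)`), the ratio
`n ↦ R_δ(n) = domainBoundaryRatio ⟨n, n/2, xc n⟩ Ω' Ω δ a b` is differentiable on `U` as soon as the
source-free partition functions of `Ω'_δ`, `Ω_δ` and the two-leg partition function of `Ω_δ` have no
zero on `U` — the form in which clause (ii) of the route's `FugacityAnalyticity` is meant to be proved.
[cite: Jacobsen2009, p. 367 (complex loop fugacity)] -/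
theorem differentiableOn_diag_domainBoundaryRatio {xc : 𝕜 → 𝕜} {U : Set 𝕜} (hxc : DifferentiableOn 𝕜 xc U)
    (Ω' Ω : Set ℂ) (δ : ℝ) (a b : Site 2)
    (hZ' : ∀ n ∈ U, (⟨n, n / 2, xc n⟩ : DiluteLoopModel 𝕜).domainPartitionFunction Ω' δ ∅ ≠ 0)
    (hZ : ∀ n ∈ U, (⟨n, n / 2, xc n⟩ : DiluteLoopModel 𝕜).domainPartitionFunction Ω δ ∅ ≠ 0)
    (hZab : ∀ n ∈ U, (⟨n, n / 2, xc n⟩ : DiluteLoopModel 𝕜).domainPartitionFunction Ω δ ({a} ∆ {b}) ≠ 0) :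
    DifferentiableOn 𝕜 (fun n => (⟨n, n / 2, xc n⟩ : DiluteLoopModel 𝕜).domainBoundaryRatio Ω' Ω δ a b) U :=
  differentiableOn_boundaryRatio differentiableOn_id (differentiableOn_id.div_const 2) hxc _ _ a b hZ' hZ hZab

end Differentiable

/-! ### Real-to-complex consistency on the route's diagonal -/

section OfReal

/-- **The real diagonal ratio, seen in `ℂ`, is the complex diagonal ratio at a real fugacity**:
`↑(R_δ(t) over ℝ) = R_δ(↑t) over ℂ` for the parameters `⟨t, t/2, x⟩` — the bridge between a real
statement in `n` (limits along `(1 - ε₀, 1]`) and a complex-analytic one (continuation in `n`).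
[cite: Jacobsen2009, p. 367 (complex loop fugacity)] -/
theorem ofReal_diag_domainBoundaryRatio (t x : ℝ) (Ω' Ω : Set ℂ) (δ : ℝ) (a b : Site 2) :
    (((⟨t, t / 2, x⟩ : DiluteLoopModel ℝ).domainBoundaryRatio Ω' Ω δ a b : ℝ) : ℂ) =
      (⟨(t : ℂ), (t : ℂ) / 2, (x : ℂ)⟩ : DiluteLoopModel ℂ).domainBoundaryRatio Ω' Ω δ a b := by
  rw [domainBoundaryRatio_eq, domainBoundaryRatio_eq, ← Complex.ofRealHom_eq_coe, map_boundaryRatio]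
  simp [map, Complex.ofRealHom_eq_coe]

end OfReal

/-! ### At a fixed mesh the diagonal ratio is pole-free near `[0, 1]` (no uniformity) -/

section PerMesh

/-- The complex diagonal model at a real point has the real model's partition functions:
`Z_{↑t, ↑t/2, ↑r}(Ω_δ; A) = ↑(Z_{t, t/2, r}(Ω_δ; A))`. [cite: Jacobsen2009, p. 367 (complex loop fugacity)] -/
theorem ofReal_diag_domainPartitionFunction (t r : ℝ) (Ω : Set ℂ) (δ : ℝ) (A : Finset (Site 2)) :
    (⟨(t : ℂ), (t : ℂ) / 2, (r : ℂ)⟩ : DiluteLoopModel ℂ).domainPartitionFunction Ω δ A =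
      ((⟨t, t / 2, r⟩ : DiluteLoopModel ℝ).partitionFunction (discreteDomainGraph Ω δ)
        (meshDomainFinset Ω δ) A : ℂ) := by
  have h := map_partitionFunction Complex.ofRealHom (⟨t, t / 2, r⟩ : DiluteLoopModel ℝ)
    (G := discreteDomainGraph Ω δ) (meshDomainFinset Ω δ) A
  rw [Complex.ofRealHom_eq_coe] at h
  rw [domainPartitionFunction, h]
  simp [map, Complex.ofRealHom_eq_coe]

/-- **Per-mesh pole-freeness is automatic.** Fix the two discretised domains (one mesh `δ`). If the
edge-fugacity curve `xc` is differentiable on an open `U₀ ⊇ [0, 1]` and takes real positive values on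
`[0, 1]`, and the legs `a ≠ b` are joined by a self-avoiding path of `Ω_δ` inside its volume, then there
is an open `U` with `[0, 1] ⊆ U ⊆ U₀` on which the diagonal ratio
`n ↦ domainBoundaryRatio ⟨n, n/2, xc n⟩ Ω' Ω δ a b` is differentiable: the three relevant partition
functions are continuous on `U₀` and, at real `t ∈ [0, 1]`, real and positive
(`one_le_partitionFunction_empty`, `partitionFunction_pos_of_path`), so `U = U₀ ∩ {all three ≠ 0}` works.
Hence in a statement asking this for all meshes `δ ≤ δ₀` with ONE `U` and a uniform bound, the whole
content is the uniformity in `δ`. [cite: Jacobsen2009, p. 367 (complex loop fugacity)] -/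
theorem exists_isOpen_differentiableOn_diag_domainBoundaryRatio {U₀ : Set ℂ} (hU₀ : IsOpen U₀)
    (h01 : ∀ t : ℝ, t ∈ Set.Icc (0 : ℝ) 1 → (t : ℂ) ∈ U₀) {xc : ℂ → ℂ} (hxc : DifferentiableOn ℂ xc U₀)
    (hx : ∀ t : ℝ, t ∈ Set.Icc (0 : ℝ) 1 → ∃ r : ℝ, 0 < r ∧ xc t = r) (Ω' Ω : Set ℂ) (δ : ℝ)
    {a b : Site 2} (hab : a ≠ b) {p : (discreteDomainGraph Ω δ).Walk a b} (hp : p.IsPath)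
    (hΛ : ∀ v ∈ p.support, v ∈ meshDomainFinset Ω δ) :
    ∃ U : Set ℂ, IsOpen U ∧ U ⊆ U₀ ∧ (∀ t : ℝ, t ∈ Set.Icc (0 : ℝ) 1 → (t : ℂ) ∈ U) ∧
      DifferentiableOn ℂ
        (fun n => (⟨n, n / 2, xc n⟩ : DiluteLoopModel ℂ).domainBoundaryRatio Ω' Ω δ a b) U := by
  -- the partition functions along the diagonal are differentiable, hence continuous, on `U₀`
  have hd : ∀ (Ω₁ : Set ℂ) (A : Finset (Site 2)), DifferentiableOn ℂ
      (fun n => (⟨n, n / 2, xc n⟩ : DiluteLoopModel ℂ).domainPartitionFunction Ω₁ δ A) U₀ :=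
    fun Ω₁ A => differentiableOn_partitionFunction differentiableOn_id (differentiableOn_id.div_const 2)
      hxc _ A
  -- at real `t ∈ [0, 1]` the source-free partition functions are real `≥ 1`
  have hZe : ∀ t : ℝ, t ∈ Set.Icc (0 : ℝ) 1 → ∀ Ω₁ : Set ℂ,
      (⟨(t : ℂ), (t : ℂ) / 2, xc t⟩ : DiluteLoopModel ℂ).domainPartitionFunction Ω₁ δ ∅ ≠ 0 := by
    intro t ht Ω₁
    obtain ⟨r, hr, hxr⟩ := hx t ht
    rw [hxr, ofReal_diag_domainPartitionFunction, Complex.ofReal_ne_zero]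
    have hw0 : (0 : ℝ) ≤ t / 2 := by linarith [ht.1]
    exact (partitionFunction_empty_pos (L := ⟨t, t / 2, r⟩) ht.1 hw0 hr.le _).ne'
  -- and the two-leg partition function of `Ω_δ` is real `> 0` (the path `p` contributes `x^{|p|}`)
  have hZab : ∀ t : ℝ, t ∈ Set.Icc (0 : ℝ) 1 →
      (⟨(t : ℂ), (t : ℂ) / 2, xc t⟩ : DiluteLoopModel ℂ).domainPartitionFunction Ω δ ({a} ∆ {b}) ≠ 0 := by
    intro t ht
    obtain ⟨r, hr, hxr⟩ := hx t ht
    rw [hxr, ofReal_diag_domainPartitionFunction, Complex.ofReal_ne_zero]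
    have hw0 : (0 : ℝ) ≤ t / 2 := by linarith [ht.1]
    exact (partitionFunction_pos_of_path
      ((discreteDomainGraph_le_meshGraph Ω δ).trans (meshGraph_le_zdGraph Ω δ))
      (L := ⟨t, t / 2, r⟩) ht.1 hw0 hr hab hp hΛ).ne'
  refine ⟨U₀ ∩ (fun n => (⟨n, n / 2, xc n⟩ : DiluteLoopModel ℂ).domainPartitionFunction Ω' δ ∅) ⁻¹' {0}ᶜ
      ∩ (fun n => (⟨n, n / 2, xc n⟩ : DiluteLoopModel ℂ).domainPartitionFunction Ω δ ∅) ⁻¹' {0}ᶜ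
      ∩ (fun n => (⟨n, n / 2, xc n⟩ : DiluteLoopModel ℂ).domainPartitionFunction Ω δ ({a} ∆ {b})) ⁻¹' {0}ᶜ,
    ?_, fun z hz => hz.1.1.1,
    fun t ht => ⟨⟨⟨h01 t ht, hZe t ht Ω'⟩, hZe t ht Ω⟩, hZab t ht⟩, ?_⟩
  · refine ContinuousOn.isOpen_inter_preimage ?_ (ContinuousOn.isOpen_inter_preimage ?_
      ((hd Ω' ∅).continuousOn.isOpen_inter_preimage hU₀ isOpen_compl_singleton) isOpen_compl_singleton)
      isOpen_compl_singleton
    · exact (hd Ω ({a} ∆ {b})).continuousOn.mono fun z hz => hz.1.1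
    · exact (hd Ω ∅).continuousOn.mono fun z hz => hz.1
  · exact differentiableOn_diag_domainBoundaryRatio (hxc.mono fun z hz => hz.1.1.1) Ω' Ω δ a b
      (fun n hn => hn.1.1.2) (fun n hn => hn.1.2) (fun n hn => hn.2)

end PerMesh

end Literature.Probability.LatticeModels.DiluteLoopModel
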